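import Literature.AlgebraicGeometry.AbelianSchemes.PolarizationTypeLocus
import Literature.AlgebraicGeometry.AbelianSchemes.LevelStructureSymplecticClassLocusClopen
import HarnessLib

/-!
# The locus where a polarised abelian scheme with level structure has type `δ` and symplectic-liftable level is
# open and closed, and represents the corresponding sub-functor ([MumfordFogartyKirwan1994] App. 7A; F-6 (V′))

Layer `Literature/AlgebraicGeometry/AbelianSchemes`, namespace `Literature.AlgebraicGeometry.AbelianSchemes.AbelianSchemeOver`.
THEOREMS ONLY (no definition, no named fact, no instance, no notation, no `sorry`).  Cell `hodgecm-mathlib` (D-0151), F-DAG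
F-6 (V′) SOCKET PACKAGING (B-plan1 (g16) 07:01:40Z; author B-p02 (g13)).  Count-neutral capital; HC_CM is proved only modulo
the 7 printed citations until rung 0 closes — nothing here is about HC.

[MumfordFogartyKirwan1994] App. 7A (pp. 234–235): «`𝒜_{g,d,n}` is the disjoint union of the open and closed subschemes
`𝒜_{g,δ,n}`»; with the symplectic-liftable level of [Deligne1971TravauxShimura, 4.12 (b)] / [Lan2013PELCompactifications,
Def. 1.3.6.2, Lemma 1.3.6.6, Cor. 1.3.6.7] the same holds for the liftable locus.  In MFK's construction of the moduli scheme
(Prop. 7.3, step (V′) of the cell's F-6) this is used in SUB-FUNCTOR form: inside the base `S = H₅` of a family `(A, λ, φ)` of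
polarised abelian schemes with a (pairing-free) level-`N` structure, the sub-functor «the pull-back has type `δ` and
symplectic-liftable level» is represented by an OPEN AND CLOSED subscheme.  Both point-set halves are ★ (type: ★
`Polarization.isClopen_setOf_forall_exists_mulHom_of_isLocallyNoetherian`; liftability: ★ `LevelStructure.isClopen_setOf_liftAt`);
this file supplies the sub-functor statement.  With the two pointwise clauses written inline,

  `Type(x)` :≡ `∀ Ω (s : Spec Ω → S) over x, ∃ ψ : (∏ ℤ/δᵢ)² →* A_s(Ω) injective with image ker λ̄_s`,
  `Lift(x)` :≡ `∀ Ω (s : Spec Ω → S) over x, ∀ Θ ample with λ̄_s = Λ(𝒪(Θ)), Nonempty (φ.SymplecticLift s Θ δ)`: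

* §1 the type clause along base change: `Polarization.hasType_baseChange_iff_forall`,
  `Polarization.HasType.baseChange_of_forall_mem_range`, `Polarization.hasType_baseChange_ι_iff` (twins of ★ FILE A §3 for
  liftability; ★ `exists_mulHom_baseChange_iff`);
* §2 the ONE-POINT criterion for the type, `Polarization.typeAt_of_exists_mulHom` (one geometric point over `x` with the
  `δ`-clause ⇒ `Type(x)`; ★ `hasType_of_exists_mulHom_at` on the connected component — twin of ★
  `LevelStructure.liftAt_of_nonempty_symplecticLift`);
* §3 THE SOCKET: `isClopen_setOf_typeAt_and_liftAt` and **`hasType_and_isSymplecticLiftable_baseChange_iff_range_subset`**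
  — for `f : S′ → S`, the pull-back `(A, λ, φ) ×_S S′` is a polarised abelian scheme OF TYPE `δ` WITH SYMPLECTIC-LIFTABLE
  LEVEL iff `f` lands in `{x | Type(x) ∧ Lift(x)}`; `…_ι_iff_subset` for open subschemes (so the clopen locus `W` is the
  largest open over which the data is a triple of the cell's moduli functor ★ `PolarizedAbelianSchemeWithLevel g N δ`).

## References
* [MumfordFogartyKirwan1994] D. Mumford, J. Fogarty, F. Kirwan, *Geometric Invariant Theory*, 3rd ed. (1994), App. 7A
  (pp. 234–235); Ch. 7 §2 Proposition 7.3 (pp. 133–134).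
* [Lan2013PELCompactifications] K.-W. Lan, *Arithmetic compactifications of PEL-type Shimura varieties* (2013), §1.3.6
  Lemma 1.3.6.6 and Cor. 1.3.6.7 (pp. 81–82).
-/

noncomputable section

universe u

open CategoryTheory CategoryTheory.Limits AlgebraicGeometry

namespace Literature.AlgebraicGeometry.AbelianSchemes

namespace AbelianSchemeOver

open Literature.AlgebraicGeometry.Motives Literature.AlgebraicGeometry.ModuliOfAbelianVarieties
  Literature.AlgebraicGeometry.Morphisms
open scoped MonObj

variable {S S' : Scheme.{u}} (A : AbelianSchemeOver S) {D : A.DualPair} (pol : A.Polarization D) {g₀ N : ℕ}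
  (φ : A.LevelStructure g₀ N) (δ : Fin g₀ → ℕ)

/-! ### §0 Plumbing -/

/-- A geometric point whose image lies in an open `U ⊆ S` factors through the open subscheme `U`. [folklore] -/
private theorem exists_lift_of_mem_opens'' (U : S.Opens) {Ω : Type u} [Field Ω] (s : Spec (.of Ω) ⟶ S)
    (hs : s.base (IsLocalRing.closedPoint Ω) ∈ U) : ∃ s' : Spec (.of Ω) ⟶ (U : Scheme.{u}), s' ≫ U.ι = s := by
  have hr : Set.range s.base ⊆ Set.range U.ι.base := by
    rintro _ ⟨p, rfl⟩
    rw [Scheme.Opens.range_ι, Subsingleton.elim p (IsLocalRing.closedPoint Ω)]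
    exact hs
  exact ⟨IsOpenImmersion.lift U.ι s hr, IsOpenImmersion.lift_fac U.ι s hr⟩

/-! ### §1 The type clause along a base change -/

/-- **`λ ×_S S′` has type `δ` iff `δ` is a polarisation type and the `δ`-clause holds for `λ` at every geometric point
`t ≫ g` of `S` coming from `S′`** (★ `Polarization.HasType` is pointwise by definition; ★ `exists_mulHom_baseChange_iff`
moves the clause across the fibre identification). [cite: MumfordFogartyKirwan1994, App. 7A (pp. 234–235)] -/
theorem Polarization.hasType_baseChange_iff_forall (g : S' ⟶ S) :
    (pol.baseChange g).HasType δ ↔ IsPolarizationType δ ∧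
      ∀ (Ω : Type u) [Field Ω] [IsAlgClosed Ω] (t : Spec (.of Ω) ⟶ S'),
        ∃ ψ : Multiplicative (((i : Fin g₀) → ZMod (δ i)) × ((i : Fin g₀) → ZMod (δ i))) →*
          (A.fibre (t ≫ g)).toAbelianVariety.Points Ω, Function.Injective ψ ∧ Set.range ψ = pol.kerPointsAt (t ≫ g) :=
  ⟨fun h => ⟨h.1, fun Ω _ _ t => (pol.exists_mulHom_baseChange_iff g δ t).1 (h.2 Ω t)⟩,
    fun h => ⟨h.1, fun Ω _ _ t => (pol.exists_mulHom_baseChange_iff g δ t).2 (h.2 Ω t)⟩⟩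

/-- **If `δ` is a polarisation type and `Type(x)` holds at every point of the image of `g : S′ → S`, then `λ ×_S S′` has
type `δ`.** [cite: MumfordFogartyKirwan1994, App. 7A (pp. 234–235)] -/
theorem Polarization.HasType.baseChange_of_forall_mem_range (g : S' ⟶ S) (hδ : IsPolarizationType δ)
    (h : ∀ x ∈ Set.range g.base, ∀ (Ω : Type u) [Field Ω] [IsAlgClosed Ω] (s : Spec (.of Ω) ⟶ S),
      s.base (IsLocalRing.closedPoint Ω) = x →
      ∃ ψ : Multiplicative (((i : Fin g₀) → ZMod (δ i)) × ((i : Fin g₀) → ZMod (δ i))) →*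
        (A.fibre s).toAbelianVariety.Points Ω, Function.Injective ψ ∧ Set.range ψ = pol.kerPointsAt s) :
    (pol.baseChange g).HasType δ :=
  (pol.hasType_baseChange_iff_forall A δ g).2 ⟨hδ, fun Ω _ _ t =>
    h _ ⟨t.base (IsLocalRing.closedPoint Ω), by rw [Scheme.Hom.comp_apply]⟩ Ω (t ≫ g) rfl⟩

/-- **On an open subscheme `U ⊆ S`: `λ ×_S U` has type `δ` iff `δ` is a polarisation type and `Type(x)` holds at every
`x ∈ U`** (geometric points of `S` over `x ∈ U` factor through `U`). [cite: MumfordFogartyKirwan1994, App. 7A (pp. 234–235)] -/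
theorem Polarization.hasType_baseChange_ι_iff (U : S.Opens) :
    (pol.baseChange U.ι).HasType δ ↔ IsPolarizationType δ ∧
      ∀ x ∈ U, ∀ (Ω : Type u) [Field Ω] [IsAlgClosed Ω] (s : Spec (.of Ω) ⟶ S),
        s.base (IsLocalRing.closedPoint Ω) = x →
        ∃ ψ : Multiplicative (((i : Fin g₀) → ZMod (δ i)) × ((i : Fin g₀) → ZMod (δ i))) →*
          (A.fibre s).toAbelianVariety.Points Ω, Function.Injective ψ ∧ Set.range ψ = pol.kerPointsAt s := by
  constructor
  · intro h
    refine ⟨h.1, fun x hx Ω _ _ s hs => ?_⟩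
    obtain ⟨s', rfl⟩ := exists_lift_of_mem_opens'' U s (hs ▸ hx)
    exact ((pol.hasType_baseChange_iff_forall A δ U.ι).1 h).2 Ω s'
  · rintro ⟨hδ, h⟩
    refine Polarization.HasType.baseChange_of_forall_mem_range A pol δ U.ι hδ fun x hx => h x ?_
    rwa [Scheme.Opens.range_ι] at hx

/-! ### §2 The one-point criterion for the type -/

/-- **ONE GEOMETRIC POINT OVER `x` WITH THE `δ`-CLAUSE GIVES `Type(x)`** (locally Noetherian base with every positive
integer invertible in its residue fields, `δ` a polarisation type): the connected component `U` of `x` is an open subscheme,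
`λ ×_S U` has type `δ` by ★ `hasType_of_exists_mulHom_at` (the clause at the lifted point), and the clause comes back down
at every geometric point over `x` — the twin of ★ `LevelStructure.liftAt_of_nonempty_symplecticLift`.
[cite: MumfordFogartyKirwan1994, App. 7A (pp. 234–235)] -/
theorem Polarization.typeAt_of_exists_mulHom [IsLocallyNoetherian S]
    (hchar : ∀ (s : S) (m : ℕ), 0 < m → (m : S.residueField s) ≠ 0) (hδ : IsPolarizationType δ) {x : S}
    {Ω₀ : Type u} [Field Ω₀] [IsAlgClosed Ω₀] (s₀ : Spec (.of Ω₀) ⟶ S) (hs₀ : s₀.base (IsLocalRing.closedPoint Ω₀) = x)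
    (h₀ : ∃ ψ : Multiplicative (((i : Fin g₀) → ZMod (δ i)) × ((i : Fin g₀) → ZMod (δ i))) →*
        (A.fibre s₀).toAbelianVariety.Points Ω₀, Function.Injective ψ ∧ Set.range ψ = pol.kerPointsAt s₀) :
    ∀ (Ω : Type u) [Field Ω] [IsAlgClosed Ω] (s : Spec (.of Ω) ⟶ S), s.base (IsLocalRing.closedPoint Ω) = x →
      ∃ ψ : Multiplicative (((i : Fin g₀) → ZMod (δ i)) × ((i : Fin g₀) → ZMod (δ i))) →*
        (A.fibre s).toAbelianVariety.Points Ω, Function.Injective ψ ∧ Set.range ψ = pol.kerPointsAt s := by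
  intro Ω _ _ s hs
  haveI := locallyConnectedSpace_of_isLocallyNoetherian S
  let U : S.Opens := ⟨connectedComponent x, isOpen_connectedComponent⟩
  haveI : PreconnectedSpace (U : Scheme.{u}) :=
    Subtype.preconnectedSpace (isPreconnected_connectedComponent (x := x))
  have hcharU : ∀ (u : (U : Scheme.{u})) (m : ℕ), 0 < m → (m : (U : Scheme.{u}).residueField u) ≠ 0 := by
    intro u m hm
    have h := (map_ne_zero (U.ι.residueFieldMap u).hom).mpr (hchar (U.ι.base u) m hm)
    rwa [map_natCast] at h
  -- the clause at the lifted point `s₀′` of `U`, the type of `λ ×_S U`, and back down at `s`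
  obtain ⟨s₀', rfl⟩ := exists_lift_of_mem_opens'' U s₀ (by rw [hs₀]; exact mem_connectedComponent)
  have hT : (pol.baseChange U.ι).HasType δ :=
    (pol.baseChange U.ι).hasType_of_exists_mulHom_at hcharU hδ s₀' ((pol.exists_mulHom_baseChange_iff U.ι δ s₀').2 h₀)
  obtain ⟨s', rfl⟩ := exists_lift_of_mem_opens'' U s (by rw [hs]; exact mem_connectedComponent)
  exact (pol.exists_mulHom_baseChange_iff U.ι δ s').1 (hT.2 Ω s')

/-! ### §3 The socket: the type-`δ`-and-liftable locus is open and closed and represents the sub-functor -/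

/-- **THE LOCUS `{x | Type(x) ∧ Lift(x)}` IS OPEN AND CLOSED** (locally Noetherian base, every positive integer invertible
in its residue fields, `δ` a polarisation type, `N ≠ 0`, relative dimension `g`): both halves are (★
`Polarization.isClopen_setOf_forall_exists_mulHom_of_isLocallyNoetherian`, ★ `LevelStructure.isClopen_setOf_liftAt`).
[cite: MumfordFogartyKirwan1994, App. 7A (pp. 234–235)] [cite: Lan2013PELCompactifications, §1.3.6 Lemma 1.3.6.6 and Cor. 1.3.6.7 (pp. 81–82)] -/
theorem isClopen_setOf_typeAt_and_liftAt [IsLocallyNoetherian S] (hg : A.IsOfRelDim g₀)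
    (hQ : ∀ M : ℕ, M ≠ 0 → ∀ s : S, (M : S.residueField s) ≠ 0) (hδ : IsPolarizationType δ) (hN : N ≠ 0) :
    IsClopen {x : S |
      (∀ (Ω : Type u) [Field Ω] [IsAlgClosed Ω] (s : Spec (.of Ω) ⟶ S), s.base (IsLocalRing.closedPoint Ω) = x →
        ∃ ψ : Multiplicative (((i : Fin g₀) → ZMod (δ i)) × ((i : Fin g₀) → ZMod (δ i))) →*
          (A.fibre s).toAbelianVariety.Points Ω, Function.Injective ψ ∧ Set.range ψ = pol.kerPointsAt s) ∧
      ∀ (Ω : Type u) [Field Ω] [IsAlgClosed Ω] (s : Spec (.of Ω) ⟶ S), s.base (IsLocalRing.closedPoint Ω) = x →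
        ∀ Θ : CartierDivisor (A.fibre s).toAbelianVariety.X.left, Θ.IsAmple → A.IsLambdaOfAt s D pol.lam Θ →
          Nonempty (φ.SymplecticLift s Θ δ)} :=
  (pol.isClopen_setOf_forall_exists_mulHom_of_isLocallyNoetherian (fun s m hm => hQ m hm.ne' s) hδ).inter
    (LevelStructure.isClopen_setOf_liftAt A pol φ δ hg hQ hN)

/-- **THE SUB-FUNCTOR «TYPE `δ` AND SYMPLECTIC-LIFTABLE LEVEL» IS REPRESENTED BY THE LOCUS** ([MumfordFogartyKirwan1994]
Prop. 7.3 / App. 7A, step (V′) of the construction of `𝒜_{g,δ,n}`): for `f : S′ → S`, the pull-back `(A, λ, φ) ×_S S′` is a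
polarised abelian scheme OF TYPE `δ` WITH SYMPLECTIC-LIFTABLE LEVEL-`N` STRUCTURE iff `f` lands in `{x | Type(x) ∧ Lift(x)}`.
«⇐»: ★ `Polarization.HasType.baseChange_of_forall_mem_range`, ★ `LevelStructure.IsSymplecticLiftable.baseChange_of_forall_mem_range`.
«⇒»: at `x = f(y)` take the geometric point `Spec κ(y)^alg → S′ → S`; the type and a symplectic lift there come from the
pull-back (★ `exists_mulHom_baseChange_iff`, ★ `nonempty_symplecticLift_of_forall_baseChange`, ★ `Polarization.exists_ample`),
and ONE point over `x` suffices (§2, ★ `LevelStructure.liftAt_of_nonempty_symplecticLift`).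
[cite: MumfordFogartyKirwan1994, Ch. 7 §2 Proposition 7.3 (pp. 133–134) and App. 7A (pp. 234–235)]
[cite: Lan2013PELCompactifications, §1.3.6 Lemma 1.3.6.6 and Cor. 1.3.6.7 (pp. 81–82)] -/
theorem hasType_and_isSymplecticLiftable_baseChange_iff_range_subset [IsLocallyNoetherian S] (hg : A.IsOfRelDim g₀)
    (hQ : ∀ M : ℕ, M ≠ 0 → ∀ s : S, (M : S.residueField s) ≠ 0) (hδ : IsPolarizationType δ) (hN : N ≠ 0)
    (f : S' ⟶ S) :
    ((pol.baseChange f).HasType δ ∧ (φ.baseChange f).IsSymplecticLiftable (pol.baseChange f) δ) ↔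
      Set.range f.base ⊆ {x : S |
        (∀ (Ω : Type u) [Field Ω] [IsAlgClosed Ω] (s : Spec (.of Ω) ⟶ S), s.base (IsLocalRing.closedPoint Ω) = x →
          ∃ ψ : Multiplicative (((i : Fin g₀) → ZMod (δ i)) × ((i : Fin g₀) → ZMod (δ i))) →*
            (A.fibre s).toAbelianVariety.Points Ω, Function.Injective ψ ∧ Set.range ψ = pol.kerPointsAt s) ∧
        ∀ (Ω : Type u) [Field Ω] [IsAlgClosed Ω] (s : Spec (.of Ω) ⟶ S), s.base (IsLocalRing.closedPoint Ω) = x →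
          ∀ Θ : CartierDivisor (A.fibre s).toAbelianVariety.X.left, Θ.IsAmple → A.IsLambdaOfAt s D pol.lam Θ →
            Nonempty (φ.SymplecticLift s Θ δ)} := by
  constructor
  · rintro ⟨hT, hL⟩ x ⟨y, rfl⟩
    -- the geometric point `Spec κ(y)^alg → S′ → S` over `f y`
    let Ω₀ : Type u := AlgebraicClosure (S'.residueField y)
    let t₀ : Spec (.of Ω₀) ⟶ S' :=
      Spec.map (CommRingCat.ofHom (algebraMap (S'.residueField y) Ω₀)) ≫ S'.fromSpecResidueField y
    have ht₀ : t₀.base (IsLocalRing.closedPoint Ω₀) = y := by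
      change (S'.fromSpecResidueField y).base _ = y
      exact Scheme.fromSpecResidueField_apply y _
    have hs₀ : (t₀ ≫ f).base (IsLocalRing.closedPoint Ω₀) = f.base y := by
      rw [Scheme.Hom.comp_apply, ht₀]
    refine ⟨?_, ?_⟩
    · -- type at `f y`: the clause at `t₀ ≫ f`, then one point suffices
      exact pol.typeAt_of_exists_mulHom A δ (fun s m hm => hQ m hm.ne' s) hδ (t₀ ≫ f) hs₀
        ((pol.exists_mulHom_baseChange_iff f δ t₀).1 (hT.2 Ω₀ t₀))
    · -- liftability at `f y`: a lift at `t₀ ≫ f` for an ample witness, then one point suffices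
      obtain ⟨Θ₀, hΘ₀, hlam₀⟩ := pol.exists_ample Ω₀ (t₀ ≫ f)
      obtain ⟨Λ₀⟩ := LevelStructure.nonempty_symplecticLift_of_forall_baseChange A f pol φ δ t₀
        (fun Θ' hΘ' hlam' => hL Ω₀ t₀ Θ' hΘ' hlam') hΘ₀ hlam₀
      exact LevelStructure.liftAt_of_nonempty_symplecticLift A pol φ δ hg hQ hN (t₀ ≫ f) hs₀ hlam₀ Λ₀
  · intro h
    exact ⟨Polarization.HasType.baseChange_of_forall_mem_range A pol δ f hδ fun x hx => (h hx).1,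
      LevelStructure.IsSymplecticLiftable.baseChange_of_forall_mem_range A f pol φ δ fun x hx => (h hx).2⟩

/-- **Open-subscheme form**: `(A, λ, φ) ×_S U` is of type `δ` with symplectic-liftable level iff `U ⊆ {x | Type(x) ∧ Lift(x)}`
— so the clopen locus is the LARGEST open subscheme over which the data is an object of the cell's moduli functor
★ `PolarizedAbelianSchemeWithLevel g N δ`. [cite: MumfordFogartyKirwan1994, Ch. 7 §2 Proposition 7.3 (pp. 133–134) and App. 7A (pp. 234–235)] -/
theorem hasType_and_isSymplecticLiftable_baseChange_ι_iff_subset [IsLocallyNoetherian S] (hg : A.IsOfRelDim g₀)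
    (hQ : ∀ M : ℕ, M ≠ 0 → ∀ s : S, (M : S.residueField s) ≠ 0) (hδ : IsPolarizationType δ) (hN : N ≠ 0)
    (U : S.Opens) :
    ((pol.baseChange U.ι).HasType δ ∧ (φ.baseChange U.ι).IsSymplecticLiftable (pol.baseChange U.ι) δ) ↔
      (U : Set S) ⊆ {x : S |
        (∀ (Ω : Type u) [Field Ω] [IsAlgClosed Ω] (s : Spec (.of Ω) ⟶ S), s.base (IsLocalRing.closedPoint Ω) = x →
          ∃ ψ : Multiplicative (((i : Fin g₀) → ZMod (δ i)) × ((i : Fin g₀) → ZMod (δ i))) →*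
            (A.fibre s).toAbelianVariety.Points Ω, Function.Injective ψ ∧ Set.range ψ = pol.kerPointsAt s) ∧
        ∀ (Ω : Type u) [Field Ω] [IsAlgClosed Ω] (s : Spec (.of Ω) ⟶ S), s.base (IsLocalRing.closedPoint Ω) = x →
          ∀ Θ : CartierDivisor (A.fibre s).toAbelianVariety.X.left, Θ.IsAmple → A.IsLambdaOfAt s D pol.lam Θ →
            Nonempty (φ.SymplecticLift s Θ δ)} := by
  rw [hasType_and_isSymplecticLiftable_baseChange_iff_range_subset A pol φ δ hg hQ hδ hN U.ι, Scheme.Opens.range_ι]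

end AbelianSchemeOver

end Literature.AlgebraicGeometry.AbelianSchemes

end
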